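import Summits.ValiantsHypothesis.ValiantsHypothesis.Theorems.LacunarySymmetroidMatrixDescartesVSQDefs

/-!
# `MatrixDescartes` census, `m = 3` row — DEFINITIONS of the all-`K` TRIDIAGONAL «Viro + square splitting» family (`ζ_sym(3,K) ≥ 7K − 13`)

HONEST FRAMING.  Definitions only (val-V1-extremal engine seat val-v1x-eng-6 g2, `--supports stmt-ValiantsHypothesis-18050`);
theorems in `…VSQTriKit`, `…VSQTriDesign`, `…VSQTriLaw`.  Nothing here bears on the crux `MatrixDescartes` (stmt-18050,
asymptotic) or on `VP ≠ VNP`.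

THE FAMILY (`K = n + 2`, `n ≥ 2`, base `B ≥ 16K²`; objects `fa, fb, fc, tau, bz, …` of `…VSQDefs`).  A symmetric TRIDIAGONAL
`3 × 3` pencil `letters3 n B` whose three levels run the `m = 2` programme one after the other, `σ = 4n + 4` apart in
`x = log_B t`: diagonal `P₀(t) = fa(t)`, `P₁(t) = (−1)^n fa(u)`, `P₂(t) = (−1)^n fc(u)` and links `Q₀(t) = B^{−δ} fb(t)`,
`Q₁(t) = fb(u)`, with `u = B^{−σ} t` and `δ = n(n+3)/2` (`dlt`; the offset that puts the level-0 crossing `P₀P₁ = Q₀²` at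
`x = 2n`, since `P₁`'s constant has height `qa` instead of `4(n+1)²`); the sign `(−1)^n` on the lower levels makes the two
crossings of every level sign changes of the determinant.  `E3 n B t = P₀P₁P₂ − Q₀²P₂ − Q₁²P₀` is the determinant
(`…VSQTriLaw.eval_det_letters3`).  TEST POINTS `tau3`: the `3n` level points of `…VSQDefs.tau` (`j < 3n`: the `a`-chain of
`P₀`, the `b²`-points and bracketed zeros of `Q₀`), the same `3n` points rescaled by `B^σ` (`3n ≤ j < 6n`: level `1`), then
`B^{2σ − 1 + 2j''}`, `j'' = 0, …, n + 1` (the `c`-chain of `P₂`): `7n + 2 = 7K − 12` points, `7K − 13` alternations.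
[folklore] Viro patchworking data; elementary.
-/

set_option linter.dupNamespace false
set_option autoImplicit false

namespace Summit.ValiantsHypothesis.ValiantsHypothesis.Theorems.LacunarySymmetroidMatrixDescartes.VSQ

/-- `δ = n(n+3)/2`, the height offset of the level-`0` link. [folklore] -/
def dlt (n : ℕ) : ℕ := n * (n + 3) / 2

/-- `σ = 4n + 4`, the delay between consecutive levels. [folklore] -/
def sg (n : ℕ) : ℕ := 4 * n + 4

/-- the tridiagonal letters `[[a_l, b_l B^{−δ}, 0], [b_l B^{−δ}, (−1)^n a_l B^{−σ d_l}, b_l B^{−σ d_l}], [0, b_l B^{−σ d_l},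
(−1)^n c_l B^{−σ d_l}]]` of the family (`K = n + 2`, base `B`). [folklore] -/
noncomputable def letters3 (n : ℕ) (B : ℝ) (l : Fin (n + 2)) : Matrix (Fin 3) (Fin 3) ℝ :=
  !![saF n l * B ^ haF n l, sbF n l * B ^ (hbF n l - (dlt n : ℤ)), 0;
    sbF n l * B ^ (hbF n l - (dlt n : ℤ)), (-1) ^ n * saF n l * B ^ (haF n l - (sg n : ℤ) * (dF n l : ℤ)),
      sbF n l * B ^ (hbF n l - (sg n : ℤ) * (dF n l : ℤ));
    0, sbF n l * B ^ (hbF n l - (sg n : ℤ) * (dF n l : ℤ)),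
      (-1) ^ n * scF n l * B ^ (hcF n l - (sg n : ℤ) * (dF n l : ℤ))]

/-- the determinant as a function of `t`: `P₀P₁P₂ − Q₀²P₂ − Q₁²P₀` with `P₀ = fa(t)`, `P₁ = (−1)^n fa(u)`, `P₂ = (−1)^n fc(u)`,
`Q₀ = B^{−δ} fb(t)`, `Q₁ = fb(u)`, `u = B^{−σ} t`. [folklore] -/
noncomputable def E3 (n : ℕ) (B t : ℝ) : ℝ :=
  fa n B t * ((-1) ^ n * fa n B (B ^ (-(sg n : ℤ)) * t)) * ((-1) ^ n * fc n B (B ^ (-(sg n : ℤ)) * t))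
    - (B ^ (-(dlt n : ℤ)) * fb n B t) ^ 2 * ((-1) ^ n * fc n B (B ^ (-(sg n : ℤ)) * t))
    - (fb n B (B ^ (-(sg n : ℤ)) * t)) ^ 2 * fa n B t

/-- the `7n + 2` test points: level `0` (`j < 3n`), level `1` (`3n ≤ j < 6n`, rescaled by `B^σ`), level `2` (`j ≥ 6n`). [folklore] -/
noncomputable def tau3 (n : ℕ) (B : ℝ) (j : ℕ) : ℝ :=
  if j < 3 * n then tau n B j
  else if j < 6 * n then B ^ (sg n : ℤ) * tau n B (j - 3 * n)
  else B ^ (2 * (sg n : ℤ) + 2 * ((j - 6 * n : ℕ) : ℤ) - 1)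

end Summit.ValiantsHypothesis.ValiantsHypothesis.Theorems.LacunarySymmetroidMatrixDescartes.VSQ
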